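import Mathlib
import Summits.ValiantsHypothesis.ValiantsHypothesis.Theorems.ValuativeGCTHeadFlipRankBoundDefs
import Summits.ValiantsHypothesis.ValiantsHypothesis.Theorems.ValuativeGCTHeadFlipRankBoundESymm

/-!
# The master identity of a relation among ALL `4n²` products `y_t · Per_ij` of the rank-one
# moment-curve pencil (crux `ValuativeGCT.ValuativeFlip`, stub `stub_fourRowPencilRank`)

Wall-breaker k1 (explicit per-side constructions), crux stmt-ValiantsHypothesis-12624, line
`four-row-count`, heart stub `stub_fourRowPencilRank` (slope `6/5`: the four-row pencil span must have
dimension `≥ 2⌊6n/5⌋² + ⌊6n/5⌋ + 2 ≈ 2.88 n²`).  We use the rank-one moment-curve pencil of the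
`HeadFlip` line (`Theorems/ValuativeGCTHeadFlipRankBoundDefs.lean`: `M(y) = diag(d_k) + u·1ᵀ`,
`d_k = a_k y₀ + y₃`, `u_k = a_k² y₁ + a_k³ y₂`, `a_k = k+1`, closed-form minors `rbPer`), whose full family
of `4n²` products has rank `3n² - 3n + 2 ≥ 2.88n²` numerically; the HeadFlip blueprint bounds the
`3n²`-subfamily with multipliers `y₀, y₃, y₁` (rank `≥ 2.5n²`, slope `21/20`).  This file starts the
FOUR-multiplier count: for a relation `Σ_ab (L_ab + M_ab)·Per_ab = 0` with `L_ab` of weight `0` and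
`M_ab` of weight `1` (weight = degree in the `B`-variables `y₁, y₂`), applying the extraction operator
`Λ = Σ_{k} ((-1)^k / k!) · π_{k+1}` (`π_j` = weighted homogeneous component of weight `j`) to the relation
and using the generating-function identities (E1), (E2) of `…RankBoundESymm.lean` termwise gives the
MASTER identity
`Σ_{a≠b} (L_aa + L_ab) u_b Ψ(ab) - Σ_{(a,b,k)} L_ab u_b u_k Ψ(abk) + Σ_a M_aa Ψ(a) - Σ_{a≠b} M_ab u_b Ψ(ab) = 0`
(`mcp_master`), of which the HeadFlip line's `stub_rbMaster` (`M_ab = μ_ab·y₁`) is the special case.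
No definitions; `Ψ = rbPsi`, `e_s = rbE`, `Per = rbPer` are the HeadFlip line's. [this crux; new]
-/

-- `Summit.ValiantsHypothesis.ValiantsHypothesis.…` is the tree's mandated single-conjunct layout (Sub = Summit).
set_option linter.dupNamespace false

namespace Summit.ValiantsHypothesis.ValiantsHypothesis.Theorems.ValuativeFlip

open MvPolynomial Finset
open scoped BigOperators
open Summit.ValiantsHypothesis.ValiantsHypothesis.Theorems.HeadFlip

noncomputable section

/-! Throughout, the `B`-weight is `![0, 1, 1, 0]` (degree in `y₁, y₂`) and the extraction operator is
written out in full: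
`Λ_N = Finset.sum (Finset.range N) fun k => ((-1)^k / k!) • weightedHomogeneousComponent ![0,1,1,0] (k+1)`
(no notation and no definition, so that this helper file stays a pure proof file). -/

/-! ### The extraction operator on weighted-homogeneous polynomials -/

/-- `Λ_N φ = ((-1)^k / k!) • φ` for `φ` weighted-homogeneous of weight `k + 1 ≤ N`. [folklore] -/
theorem mcp_extract_of_weight_succ {N k : ℕ} (hk : k < N) {φ : MvPolynomial (Fin 4) ℂ}
    (hφ : IsWeightedHomogeneous (![0, 1, 1, 0] : Fin 4 → ℕ) φ (k + 1)) :
    (Finset.sum (Finset.range N) fun k : ℕ => (((-1 : ℂ) ^ k / ((Nat.factorial k : ℕ) : ℂ)) • MvPolynomial.weightedHomogeneousComponent (R := ℂ) (![0, 1, 1, 0] : Fin 4 → ℕ) (k + 1))) φ = ((-1 : ℂ) ^ k / ((k.factorial : ℕ) : ℂ)) • φ := by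
  rw [LinearMap.sum_apply, Finset.sum_eq_single k]
  · rw [LinearMap.smul_apply, hφ.weightedHomogeneousComponent_same]
  · intro j _ hjk
    rw [LinearMap.smul_apply, hφ.weightedHomogeneousComponent_ne (j + 1) (by omega), smul_zero]
  · intro h
    exact absurd (Finset.mem_range.2 hk) h

/-- `Λ_N φ = 0` for `φ` weighted-homogeneous of weight `0`. [folklore] -/
theorem mcp_extract_of_weight_zero (N : ℕ) {φ : MvPolynomial (Fin 4) ℂ}
    (hφ : IsWeightedHomogeneous (![0, 1, 1, 0] : Fin 4 → ℕ) φ 0) : (Finset.sum (Finset.range N) fun k : ℕ => (((-1 : ℂ) ^ k / ((Nat.factorial k : ℕ) : ℂ)) • MvPolynomial.weightedHomogeneousComponent (R := ℂ) (![0, 1, 1, 0] : Fin 4 → ℕ) (k + 1))) φ = 0 := by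
  rw [LinearMap.sum_apply]
  refine Finset.sum_eq_zero fun j _ => ?_
  rw [LinearMap.smul_apply, hφ.weightedHomogeneousComponent_ne (j + 1) (by omega), smul_zero]

/-- A natural-number scalar in the polynomial ring acts as the corresponding complex scalar. [folklore] -/
theorem mcp_natCast_mul (m : ℕ) (φ : MvPolynomial (Fin 4) ℂ) :
    (m : MvPolynomial (Fin 4) ℂ) * φ = (m : ℂ) • φ := by
  rw [smul_eq_C_mul, map_natCast]

/-- `e_s(T)` vanishes beyond the cardinality (restated with `≤`). [HeadFlip line] -/
theorem mcp_rbE_eq_zero {n s : ℕ} {T : Finset (Fin n)} (h : T.card < s) : rbE s T = 0 :=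
  rbE_eq_zero_of_card_lt h


/-- Inside a product, a natural-number scalar factor can be pulled out as a complex scalar. [folklore] -/
theorem mcp_mul_natCast_mul (m : ℕ) (ψ φ : MvPolynomial (Fin 4) ℂ) :
    ψ * ((m : MvPolynomial (Fin 4) ℂ) * φ) = (m : ℂ) • (ψ * φ) := by
  rw [mul_left_comm, mcp_natCast_mul]

/-- `[n] ∖ {a} = ([n]).erase a` as finsets. [folklore] -/
theorem mcp_univ_sdiff_singleton {n : ℕ} (a : Fin n) :
    (Finset.univ : Finset (Fin n)) \ {a} = Finset.univ.erase a :=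
  Finset.sdiff_singleton_eq_erase a _

/-- `[n] ∖ {a, b} = (([n]).erase a).erase b` as finsets. [folklore] -/
theorem mcp_univ_sdiff_pair {n : ℕ} (a b : Fin n) :
    (Finset.univ : Finset (Fin n)) \ {a, b} = (Finset.univ.erase a).erase b := by
  ext k
  simp only [mem_sdiff, mem_univ, mem_insert, mem_singleton, true_and, not_or, mem_erase, ne_eq,
    and_true]
  tauto

/-- `[n] ∖ {a, b, k} = ((([n]).erase a).erase b).erase k` as finsets. [folklore] -/
theorem mcp_univ_sdiff_triple {n : ℕ} (a b k : Fin n) :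
    (Finset.univ : Finset (Fin n)) \ {a, b, k} = ((Finset.univ.erase a).erase b).erase k := by
  ext l
  simp only [mem_sdiff, mem_univ, mem_insert, mem_singleton, true_and, not_or, mem_erase, ne_eq,
    and_true]
  tauto

/-- The cardinality bookkeeping `|[n] ∖ a| + 1 = n`. [folklore] -/
theorem mcp_card_erase_add_one {n : ℕ} (a : Fin n) : (Finset.univ.erase a).card + 1 = n := by
  rw [card_erase_of_mem (mem_univ a), card_univ, Fintype.card_fin]
  have := Fin.pos a
  omega

/-- The cardinality bookkeeping `|[n] ∖ {a,b}| + 2 = n` for `a ≠ b`. [folklore] -/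
theorem mcp_card_erase_erase_add_two {n : ℕ} {a b : Fin n} (hab : a ≠ b) :
    ((Finset.univ.erase a).erase b).card + 2 = n := by
  rw [card_erase_of_mem (mem_erase.2 ⟨hab.symm, mem_univ b⟩), card_erase_of_mem (mem_univ a),
    card_univ, Fintype.card_fin]
  have := Fin.pos a
  have : 2 ≤ n := by
    by_contra h
    have : Subsingleton (Fin n) := Fin.subsingleton_iff_le_one.2 (by omega)
    exact hab (Subsingleton.elim a b)
  omega

/-! ### The extraction operator on the four kinds of terms of a relation -/

/-- Weight-`1` multiplier, diagonal minor: `Λ (M · Per_aa) = M · Ψ({a})` ((E1) on `[n] ∖ a`). [this crux] -/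
theorem mcp_extract_M_diag {n N : ℕ} (hN : n ≤ N) (a : Fin n) {M : MvPolynomial (Fin 4) ℂ}
    (hM : IsWeightedHomogeneous (![0, 1, 1, 0] : Fin 4 → ℕ) M 1) :
    (Finset.sum (Finset.range N) fun k : ℕ => (((-1 : ℂ) ^ k / ((Nat.factorial k : ℕ) : ℂ)) • MvPolynomial.weightedHomogeneousComponent (R := ℂ) (![0, 1, 1, 0] : Fin 4 → ℕ) (k + 1))) (M * rbPer a a) = M * rbPsi {a} := by
  rw [rbPer_diag, Finset.mul_sum]
  simp_rw [mcp_mul_natCast_mul]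
  rw [map_sum]
  have hterm : ∀ s ∈ Finset.range n,
      (Finset.sum (Finset.range N) fun k : ℕ => (((-1 : ℂ) ^ k / ((Nat.factorial k : ℕ) : ℂ)) • MvPolynomial.weightedHomogeneousComponent (R := ℂ) (![0, 1, 1, 0] : Fin 4 → ℕ) (k + 1))) (((s.factorial : ℕ) : ℂ) • (M * rbE s (Finset.univ.erase a))) =
        M * ((-1 : MvPolynomial (Fin 4) ℂ) ^ s * rbE s (Finset.univ.erase a)) := by
    intro s hs
    have hw : IsWeightedHomogeneous (![0, 1, 1, 0] : Fin 4 → ℕ) (M * rbE s (Finset.univ.erase a)) (s + 1) := by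
      simpa [add_comm] using hM.mul (rbE_isWeightedHomogeneous s (Finset.univ.erase a))
    rw [map_smul, mcp_extract_of_weight_succ (lt_of_lt_of_le (mem_range.1 hs) hN) hw, smul_smul]
    have hfac : ((s.factorial : ℕ) : ℂ) ≠ 0 := Nat.cast_ne_zero.2 (Nat.factorial_ne_zero s)
    rw [show ((s.factorial : ℕ) : ℂ) * ((-1 : ℂ) ^ s / ((s.factorial : ℕ) : ℂ)) = (-1 : ℂ) ^ s from by
      field_simp, smul_eq_C_mul, map_pow, map_neg, map_one]
    ring
  have hE := stub_rbE1 (Finset.univ.erase a)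
  rw [mcp_card_erase_add_one a] at hE
  rw [Finset.sum_congr rfl hterm, ← Finset.mul_sum, hE, rbPsi, mcp_univ_sdiff_singleton]

/-- Weight-`1` multiplier, off-diagonal minor: `Λ (M · Per_ab) = -M · u_b · Ψ({a,b})` ((E1) on
`[n] ∖ {a,b}`). [this crux] -/
theorem mcp_extract_M_offdiag {n N : ℕ} (hN : n + 1 ≤ N) {a b : Fin n} (hab : a ≠ b)
    {M : MvPolynomial (Fin 4) ℂ} (hM : IsWeightedHomogeneous (![0, 1, 1, 0] : Fin 4 → ℕ) M 1) :
    (Finset.sum (Finset.range N) fun k : ℕ => (((-1 : ℂ) ^ k / ((Nat.factorial k : ℕ) : ℂ)) • MvPolynomial.weightedHomogeneousComponent (R := ℂ) (![0, 1, 1, 0] : Fin 4 → ℕ) (k + 1))) (M * rbPer a b) = -(M * rbU b * rbPsi {a, b}) := by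
  rw [rbPer_offdiag a b hab, ← mul_assoc, Finset.mul_sum]
  simp_rw [mcp_mul_natCast_mul]
  rw [map_sum]
  set T := (Finset.univ.erase a).erase b with hT
  have hterm : ∀ s ∈ Finset.range n,
      (Finset.sum (Finset.range N) fun k : ℕ => (((-1 : ℂ) ^ k / ((Nat.factorial k : ℕ) : ℂ)) • MvPolynomial.weightedHomogeneousComponent (R := ℂ) (![0, 1, 1, 0] : Fin 4 → ℕ) (k + 1))) ((((s + 1).factorial : ℕ) : ℂ) • (M * rbU b * rbE s T)) =
        -(M * rbU b * ((-1 : MvPolynomial (Fin 4) ℂ) ^ s * rbE s T)) := by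
    intro s hs
    have hw : IsWeightedHomogeneous (![0, 1, 1, 0] : Fin 4 → ℕ) (M * rbU b * rbE s T) ((s + 1) + 1) := by
      have h := (hM.mul (rbU_isWeightedHomogeneous b)).mul (rbE_isWeightedHomogeneous s T)
      convert h using 1
      ring
    rw [map_smul, mcp_extract_of_weight_succ (by have := mem_range.1 hs; omega) hw, smul_smul]
    have hfac : (((s + 1).factorial : ℕ) : ℂ) ≠ 0 := Nat.cast_ne_zero.2 (Nat.factorial_ne_zero _)
    rw [show (((s + 1).factorial : ℕ) : ℂ) * ((-1 : ℂ) ^ (s + 1) / (((s + 1).factorial : ℕ) : ℂ)) =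
      -(-1 : ℂ) ^ s from by field_simp; ring, smul_eq_C_mul, map_neg, map_pow, map_neg, map_one]
    ring
  rw [Finset.sum_congr rfl hterm, Finset.sum_neg_distrib, ← Finset.mul_sum]
  -- the top term of the sum vanishes, the rest is (E1) on `T`
  have hcard : T.card + 2 = n := mcp_card_erase_erase_add_two hab
  have hsum : ∑ s ∈ Finset.range n, (-1 : MvPolynomial (Fin 4) ℂ) ^ s * rbE s T =
      ∏ k ∈ T, (rbD k - rbU k) := by
    have hrange : Finset.range n = Finset.range (T.card + 1 + 1) :=
      congrArg Finset.range (by omega)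
    rw [← stub_rbE1 T, hrange, Finset.sum_range_succ, mcp_rbE_eq_zero (by omega), mul_zero, add_zero]
  rw [hsum, rbPsi, mcp_univ_sdiff_pair]


/-- Weight-`0` multiplier, diagonal minor: `Λ (L · Per_aa) = L · Σ_{b ≠ a} u_b Ψ({a,b})` ((E2) on
`[n] ∖ a`). [this crux] -/
theorem mcp_extract_L_diag {n N : ℕ} (hN : n ≤ N) (a : Fin n) {L : MvPolynomial (Fin 4) ℂ}
    (hL : IsWeightedHomogeneous (![0, 1, 1, 0] : Fin 4 → ℕ) L 0) :
    (Finset.sum (Finset.range N) fun k : ℕ => (((-1 : ℂ) ^ k / ((Nat.factorial k : ℕ) : ℂ)) • MvPolynomial.weightedHomogeneousComponent (R := ℂ) (![0, 1, 1, 0] : Fin 4 → ℕ) (k + 1))) (L * rbPer a a) = L * ∑ b ∈ Finset.univ.erase a, rbU b * rbPsi {a, b} := by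
  obtain ⟨n', rfl⟩ : ∃ n', n = n' + 1 := ⟨n - 1, by have := Fin.pos a; omega⟩
  set T := Finset.univ.erase a with hT
  rw [rbPer_diag, Finset.mul_sum]
  simp_rw [mcp_mul_natCast_mul]
  rw [map_sum, Finset.sum_range_succ', Nat.factorial_zero, Nat.cast_one, one_smul,
    mcp_extract_of_weight_zero N (by simpa using hL.mul (rbE_isWeightedHomogeneous 0 T)), add_zero]
  have hterm : ∀ k ∈ Finset.range n',
      (Finset.sum (Finset.range N) fun k : ℕ => (((-1 : ℂ) ^ k / ((Nat.factorial k : ℕ) : ℂ)) • MvPolynomial.weightedHomogeneousComponent (R := ℂ) (![0, 1, 1, 0] : Fin 4 → ℕ) (k + 1))) ((((k + 1).factorial : ℕ) : ℂ) • (L * rbE (k + 1) T)) =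
        L * ((-1 : MvPolynomial (Fin 4) ℂ) ^ (k + 1 + 1) * (((k + 1 : ℕ) : MvPolynomial (Fin 4) ℂ) * rbE (k + 1) T)) := by
    intro k hk
    have hw : IsWeightedHomogeneous (![0, 1, 1, 0] : Fin 4 → ℕ) (L * rbE (k + 1) T) (k + 1) := by
      simpa using hL.mul (rbE_isWeightedHomogeneous (k + 1) T)
    rw [map_smul, mcp_extract_of_weight_succ (by have := mem_range.1 hk; omega) hw, smul_smul]
    have hfac : ((k.factorial : ℕ) : ℂ) ≠ 0 := Nat.cast_ne_zero.2 (Nat.factorial_ne_zero _)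
    rw [show (((k + 1).factorial : ℕ) : ℂ) * ((-1 : ℂ) ^ k / ((k.factorial : ℕ) : ℂ)) =
      ((k + 1 : ℕ) : ℂ) * (-1 : ℂ) ^ k from by
        rw [Nat.factorial_succ, Nat.cast_mul]; field_simp, smul_eq_C_mul, map_mul, map_pow,
      map_neg, map_one, map_natCast]
    ring
  rw [Finset.sum_congr rfl hterm, ← Finset.mul_sum]
  -- (E2) on `T`, with its vanishing `s = 0` term peeled off
  have hE := stub_rbE2 T
  rw [mcp_card_erase_add_one a, Finset.sum_range_succ', Nat.cast_zero, zero_mul, mul_zero, add_zero] at hE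
  simp_rw [Nat.cast_succ] at hE ⊢
  rw [hE]
  congr 1
  refine Finset.sum_congr rfl fun b _ => ?_
  rw [rbPsi, mcp_univ_sdiff_pair]

/-- Weight-`0` multiplier, off-diagonal minor:
`Λ (L · Per_ab) = L · u_b · Ψ({a,b}) - L · u_b · Σ_{k ∉ {a,b}} u_k Ψ({a,b,k})` ((E1) and (E2) on
`[n] ∖ {a,b}`). [this crux] -/
theorem mcp_extract_L_offdiag {n N : ℕ} (hN : n ≤ N) {a b : Fin n} (hab : a ≠ b)
    {L : MvPolynomial (Fin 4) ℂ} (hL : IsWeightedHomogeneous (![0, 1, 1, 0] : Fin 4 → ℕ) L 0) :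
    (Finset.sum (Finset.range N) fun k : ℕ => (((-1 : ℂ) ^ k / ((Nat.factorial k : ℕ) : ℂ)) • MvPolynomial.weightedHomogeneousComponent (R := ℂ) (![0, 1, 1, 0] : Fin 4 → ℕ) (k + 1))) (L * rbPer a b) = L * rbU b * rbPsi {a, b} -
      L * rbU b * ∑ k ∈ (Finset.univ.erase a).erase b, rbU k * rbPsi {a, b, k} := by
  rw [rbPer_offdiag a b hab, ← mul_assoc, Finset.mul_sum]
  simp_rw [mcp_mul_natCast_mul]
  rw [map_sum]
  set T := (Finset.univ.erase a).erase b with hT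
  have hterm : ∀ s ∈ Finset.range n,
      (Finset.sum (Finset.range N) fun k : ℕ => (((-1 : ℂ) ^ k / ((Nat.factorial k : ℕ) : ℂ)) • MvPolynomial.weightedHomogeneousComponent (R := ℂ) (![0, 1, 1, 0] : Fin 4 → ℕ) (k + 1))) ((((s + 1).factorial : ℕ) : ℂ) • (L * rbU b * rbE s T)) =
        L * rbU b * ((-1 : MvPolynomial (Fin 4) ℂ) ^ s * rbE s T) -
          L * rbU b * ((-1 : MvPolynomial (Fin 4) ℂ) ^ (s + 1) * ((s : MvPolynomial (Fin 4) ℂ) * rbE s T)) := by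
    intro s hs
    have hw : IsWeightedHomogeneous (![0, 1, 1, 0] : Fin 4 → ℕ) (L * rbU b * rbE s T) (s + 1) := by
      have h := (hL.mul (rbU_isWeightedHomogeneous b)).mul (rbE_isWeightedHomogeneous s T)
      convert h using 1
      ring
    rw [map_smul, mcp_extract_of_weight_succ (lt_of_lt_of_le (mem_range.1 hs) hN) hw, smul_smul]
    have hfac : ((s.factorial : ℕ) : ℂ) ≠ 0 := Nat.cast_ne_zero.2 (Nat.factorial_ne_zero _)
    rw [show (((s + 1).factorial : ℕ) : ℂ) * ((-1 : ℂ) ^ s / ((s.factorial : ℕ) : ℂ)) =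
      ((s + 1 : ℕ) : ℂ) * (-1 : ℂ) ^ s from by
        rw [Nat.factorial_succ, Nat.cast_mul]; field_simp, smul_eq_C_mul, map_mul, map_pow,
      map_neg, map_one, map_natCast]
    push_cast
    ring
  rw [Finset.sum_congr rfl hterm, Finset.sum_sub_distrib, ← Finset.mul_sum, ← Finset.mul_sum]
  -- both sums lose their (vanishing) top term and become (E1), (E2) on `T`
  have hcard : T.card + 2 = n := mcp_card_erase_erase_add_two hab
  have hrange : Finset.range n = Finset.range (T.card + 1 + 1) := congrArg Finset.range (by omega)
  have h1 : ∑ s ∈ Finset.range n, (-1 : MvPolynomial (Fin 4) ℂ) ^ s * rbE s T = rbPsi {a, b} := by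
    rw [← mcp_univ_sdiff_pair] at hT
    rw [hrange, Finset.sum_range_succ, mcp_rbE_eq_zero (by omega), mul_zero, add_zero, stub_rbE1 T,
      rbPsi, hT]
  have h2 : ∑ s ∈ Finset.range n, (-1 : MvPolynomial (Fin 4) ℂ) ^ (s + 1) * ((s : MvPolynomial (Fin 4) ℂ) * rbE s T) =
      ∑ k ∈ T, rbU k * rbPsi {a, b, k} := by
    rw [hrange, Finset.sum_range_succ, mcp_rbE_eq_zero (by omega), mul_zero, mul_zero, add_zero,
      stub_rbE2 T]
    refine Finset.sum_congr rfl fun k _ => ?_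
    rw [rbPsi, mcp_univ_sdiff_triple]
  rw [h1, h2]


/-! ### The master identity -/

/-- **MASTER identity of a relation** (four multipliers).  If `Σ_ab (L_ab + M_ab)·Per_ab = 0` with every
`L_ab` of `B`-weight `0` and every `M_ab` of `B`-weight `1`, then
`Σ_{a≠b} (L_aa + L_ab) u_b Ψ({a,b}) - Σ_{(a,b,k) distinct} L_ab u_b u_k Ψ({a,b,k})
  + (Σ_a M_aa Ψ({a}) - Σ_{a≠b} M_ab u_b Ψ({a,b})) = 0`
(apply `Λ_{n+1}` to the relation and use the four extraction lemmas).  The HeadFlip line's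
`stub_rbMaster` is the case `L = rbEll c`, `M_ab = c(2,(a,b))·y₁`. [this crux; new] -/
theorem mcp_master : ∀ {n : ℕ} (L M : Fin n → Fin n → MvPolynomial (Fin 4) ℂ),
    (∀ a b, MvPolynomial.IsWeightedHomogeneous (![0, 1, 1, 0] : Fin 4 → ℕ) (L a b) 0) →
    (∀ a b, MvPolynomial.IsWeightedHomogeneous (![0, 1, 1, 0] : Fin 4 → ℕ) (M a b) 1) →
    (∑ a, ∑ b, (L a b + M a b) * rbPer a b = 0) →
    (∑ a, ∑ b ∈ Finset.univ.erase a, (L a a + L a b) * rbU b * rbPsi {a, b}) -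
      (∑ a, ∑ b ∈ Finset.univ.erase a, ∑ k ∈ (Finset.univ.erase a).erase b,
        L a b * rbU b * rbU k * rbPsi {a, b, k}) +
      ((∑ a, M a a * rbPsi {a}) - ∑ a, ∑ b ∈ Finset.univ.erase a, M a b * rbU b * rbPsi {a, b}) = 0 := by
  intro n L M hL hM hrel
  have hsplit : ∀ a, (Finset.sum (Finset.range (n + 1)) fun k : ℕ => (((-1 : ℂ) ^ k / ((Nat.factorial k : ℕ) : ℂ)) • MvPolynomial.weightedHomogeneousComponent (R := ℂ) (![0, 1, 1, 0] : Fin 4 → ℕ) (k + 1))) (∑ b, (L a b + M a b) * rbPer a b) =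
      (L a a * ∑ b ∈ Finset.univ.erase a, rbU b * rbPsi {a, b} + M a a * rbPsi {a}) +
      ∑ b ∈ Finset.univ.erase a, ((L a b * rbU b * rbPsi {a, b} -
        L a b * rbU b * ∑ k ∈ (Finset.univ.erase a).erase b, rbU k * rbPsi {a, b, k}) +
        -(M a b * rbU b * rbPsi {a, b})) := by
    intro a
    rw [← Finset.add_sum_erase _ _ (mem_univ a), map_add, map_sum, add_mul, map_add,
      mcp_extract_L_diag (Nat.le_succ n) a (hL a a), mcp_extract_M_diag (Nat.le_succ n) a (hM a a)]
    congr 1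
    refine Finset.sum_congr rfl fun b hb => ?_
    have hab : a ≠ b := (Finset.mem_erase.1 hb).1.symm
    rw [add_mul, map_add, mcp_extract_L_offdiag (Nat.le_succ n) hab (hL a b),
      mcp_extract_M_offdiag le_rfl hab (hM a b)]
  have h := congrArg (fun φ => (Finset.sum (Finset.range (n + 1)) fun k : ℕ => (((-1 : ℂ) ^ k / ((Nat.factorial k : ℕ) : ℂ)) • MvPolynomial.weightedHomogeneousComponent (R := ℂ) (![0, 1, 1, 0] : Fin 4 → ℕ) (k + 1))) φ) hrel
  rw [map_zero, map_sum, Finset.sum_congr rfl fun a _ => hsplit a] at h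
  rw [← h]
  simp only [Finset.sum_add_distrib, Finset.sum_sub_distrib, Finset.sum_neg_distrib, Finset.mul_sum,
    add_mul, mul_assoc]
  abel

end

end Summit.ValiantsHypothesis.ValiantsHypothesis.Theorems.ValuativeFlip
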